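import Summits.KontsevichZagierPeriods.KontsevichZagierPeriods.Theorems.MzvKernelInKZTwoPosetsTransfer
import Summits.KontsevichZagierPeriods.KontsevichZagierPeriods.Theorems.MzvKernelInKZTwoPosetsCubicalChart
import Summits.KontsevichZagierPeriods.KontsevichZagierPeriods.Theorems.MzvKernelInKZTwoPosetsHoffmanIndependence
import Summits.KontsevichZagierPeriods.KontsevichZagierPeriods.Theorems.MzvKernelInKZTwoPosetsShuffleProduct
import Summits.KontsevichZagierPeriods.KontsevichZagierPeriods.Theorems.MzvKernelInKZTwoPosetsEdsCertificateLow
import Summits.KontsevichZagierPeriods.KontsevichZagierPeriods.Theorems.MzvKernelInKZTwoPosetsFurushoBridge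
import Summits.KontsevichZagierPeriods.KontsevichZagierPeriods.Theorems.MzvKernelInKZTwoPosetsInteriorLanden
import Summits.KontsevichZagierPeriods.KontsevichZagierPeriods.Theorems.MzvKernelInKZTwoPosetsHoffmanDepthOne
import Summits.KontsevichZagierPeriods.KontsevichZagierPeriods.Theorems.FurushoPentagonStuffleInKZ

/-!
# `MzvKernelInKZ` (stmt-KontsevichZagierPeriods-3914) — what line two-posets-interior-landen proves

Route `LinRedNormalForm`, crux `MzvKernelInKZ`: the kernel of evaluation on the `ℤ`-span of the MZV
word representations `[Δ_w, q·∏ω_ε]` lies in `KZ.relations`. This file assembles the line's landed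
theorems (`Theorems/MzvKernelInKZTwoPosets*.lean`) into:

* (weight 4) THE WEIGHT-4 RUNG `WeightKernel 4` is unconditional in the tree twice over: the
  disprover's `Negative.weightKernel_four` (Euler's `3ζ(4) = 4ζ(2,2)` by Calabi's change of
  variables, `Negative/EulerFour.lean`) and, along THIS line, `Negative.weightKernel_four_iff_hoffman`
  fed with `cHoffman4_mem_relations_of stub_cubicalChart stub_interiorLanden`
  (`…TwoPosetsHoffmanDepthOne.lean`: order polytope, forest chart, interior Landen `E′`, one
  positive partial fraction, cubical charts — rules (1a), (1b), (2) only); not restated here.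
* `stuffleProductInKZ_of_tree` — the stuffle product on the canonical word representations,
  unconditionally (route `FurushoPentagon`'s proved `StuffleInKZ_of` through the landed bridge).
* `MzvKernelInKZ_of_furusho` — the crux GIVEN exactly three named inputs: route `FurushoPentagon`'s
  crux `HoffmanRelationInKZ` (item stmt-KontsevichZagierPeriods-3930: Hoffman's relation in every
  depth), completeness of the per-weight EDS certificates in all weights (`EdsComplete`; decidable,
  landed for `N ≤ 6`; in general Ihara–Kaneko–Zagier 2006, Conjecture 1 with Zagier's dimension
  conjecture) and `ℚ`-independence of the real Hoffman values (`HoffmanIndependent`); the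
  depth-one Hoffman relations on this path are the line's own (`stub_hoffmanDepthOne`, via `E′`).
* `MzvKernelInKZ_of_zagier` — the same with `HoffmanIndependent` replaced by the tree's
  `ZagierConjecture` (open) and Brown's theorem `hoffmanSpan_eq_mzvSpace` (named fact).

Sources: M. Kontsevich, D. Zagier, *Periods* (2001), §1.2; M. E. Hoffman, Pacific J. Math. 152
(1992), Thm 5.1; K. Ihara, M. Kaneko, D. Zagier, Compos. Math. 142 (2006), §1; M. Kaneko,
S. Yamamoto, Selecta Math. 24 (2018), Thm 4.1; D. Zagier, ECM 1992 (1994), §9; F. Brown, Ann. of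
Math. 175 (2012), Thm 1.1.
-/

noncomputable section

namespace Summit.KontsevichZagierPeriods.MzvKernelInKZ.TwoPosets

open Literature.NumberTheory.Transcendental
open Summit.KontsevichZagierPeriods.KontsevichZagierPeriods.Theses.FurushoPentagon (HoffmanRelationInKZ)
open Summit.KontsevichZagierPeriods.KontsevichZagierPeriods.Theses.LinRedNormalForm (MzvKernelInKZ)

/-- **The stuffle product on the canonical word representations, unconditionally** (registered name
`stuffleProductInKZ_of_tree`): from route `FurushoPentagon`'s theorem `StuffleInKZ_of` through the
bridge `stub_stuffleProductOfFurusho`. -/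
theorem stuffleProductInKZ_of_tree : StuffleProductInKZ :=
  stub_stuffleProductOfFurusho Summit.KontsevichZagierPeriods.FurushoPentagon.StuffleInKZ.StuffleInKZ_of

/-- **The crux from three named inputs** (registered name `MzvKernelInKZ_of_furusho`): Hoffman's
relation in the calculus in every depth (route FurushoPentagon's item 3930), completeness of the
EDS certificates in every weight, and `ℚ`-independence of the real Hoffman values imply that every
vanishing `ℤ`-combination of MZV word representations is a Kontsevich–Zagier relation
(`transferCore` with the line's realisation, shuffle, stuffle, depth-one Hoffman (via `E′`) and
cubical-chart theorems). -/
theorem MzvKernelInKZ_of_furusho :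
    HoffmanRelationInKZ → EdsComplete → HoffmanIndependent → MzvKernelInKZ :=
  fun hH hE hHI =>
    transferCore stub_realisation (stub_hoffmanDepthOne stub_cubicalChart stub_interiorLanden)
      stub_shuffleProduct stuffleProductInKZ_of_tree (stub_hoffmanDeepOfFurusho hH) hE hHI

/-- **The crux, conditionally on the tree's transcendence inputs** (registered name
`MzvKernelInKZ_of_zagier`): item 3930 + certificate completeness + Zagier's conjecture (the open
`ZagierConjecture`) + Brown's theorem (the named fact `hoffmanSpan_eq_mzvSpace`). -/
theorem MzvKernelInKZ_of_zagier :
    HoffmanRelationInKZ → EdsComplete → ZagierConjecture → hoffmanSpan_eq_mzvSpace → MzvKernelInKZ :=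
  fun hH hE hZ hB => MzvKernelInKZ_of_furusho hH hE (stub_hoffmanIndependentOfZagier hZ hB)

end Summit.KontsevichZagierPeriods.MzvKernelInKZ.TwoPosets
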